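import Mathlib
import Literature.MathematicalPhysics.QuantumFieldTheory.Balaban1983to89.B4Sect5Torus
import Literature.MathematicalPhysics.QuantumFieldTheory.Balaban1983to89.B5Global115

/-!
# B5TorusCover — the `M₀`-cube cover of the unit torus: multiplicities, sparse row sums, ball counts and the
# unit-lattice row sums of (1.131) / (1.115)–(1.117) / (1.133), UNIFORMLY in the torus and in `M₀`

[cite: Balaban1984PropagatorsI]  T. Bałaban, *Propagators and renormalization transformations for lattice gauge
theories. I*, Commun. Math. Phys. **95** (1984) 17–40 (= B5 of the series), pp. 36–39 [PDF 20–23]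
(renders `run/shared/lean/pub/pub-balaban/b2b-balaban-ref1/pages/1984-cmp95-propagators-rt-I/…-p020-x2.png …`).

HONEST FRAMING.  Nothing printed by Bałaban is asserted here and no hypothesis is a quotation.  This module is the
GEOMETRIC half of the instantiation contract that the b05 lineage left as *located leaves* of the B4 → B5 chain
(cell records GAPS G-B5-21/22 (`URow`, `CarrierFacts`/`MapFacts.nbr_card`), G-B5-24 (c), G-B5-26 (e)):

* `B5Local114.Realisation.hν` / `.hrow` — the cube cover of p. 36 (verbatim; certified C-pv14-13, C-ref5-61: "We consider the
  lattice of cubes of size M₀, M₀ = L^{m₀}, defined by the lattice T^{(k+m₀)}_{M₀}, and cubes □_z of size 2M₀ and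
  with a center at the point z ∈ T^{(k+m₀)}_{M₀}. These cubes cover the lattice T_η.") enters the kernel theorem
  `B5Local114.local114_of_realisation` only through two numbers: a MULTIPLICITY `ν ≥ #{z : |x − z| ≤ c̄M₀}` and a
  SPARSE ROW SUM `K̄ ≥ Σ_{z′} e^{−|z−z′|/(2M₀)}` over the centres (the printed `Σ_{x∈Z^d} e^{−δ₀M₀|x|}` of (1.131)
  p. 38 with `δ₀M₀ = ½`), both required UNIFORMLY in the torus AND in the cube scale `M₀ ≥ 1` (the kernel theorem
  quantifies over every integer `M₀ ≥ 1`, cell DIVERGENCE D-b05g5.1);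
* `B5Global115.global_of_prop12` (`hRow`), `B5Transfer133.URow` / `B5Global115.S2_via132` (`hRowU`, `hRow`) — the
  unit-lattice row sums `Σ_{y′∈T₁} e^{−κ|y−y′|} ≤ Λ(κ)` uniformly in the family of tori;
* `B5Transfer133.CarrierFacts.nbr_card` / `B5Transfer132.MapFacts.nbr_card` — a neighbourhood of radius `r0` of the
  unit lattice has at most `Nn` points, uniformly.

WHAT IS PROVED (Mathlib-elementary; the torus layer `B4Sect5Torus` §8 — sites `TSite d N = Π_i Fin (N i)`, the sup
circular distance `tdist`, the uniform full row sum `torusSum_le` — is used READ-ONLY by name):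
§1 one circle `ℤ/Nℤ`, `N ≥ 1`: ball counts `#{t : dist(c − t, Nℤ) ≤ R} ≤ 2⌊R⌋ + 1` (`circBall_card_le`); the cover
   by `nC N M₀ = max 1 ⌊N/M₀⌋` arcs with left end-points ("centres") `M₀k`, `k < nC N M₀` — for `M₀ | N` exactly the
   printed centre lattice `T^{(k+m₀)}_{M₀} = M₀·(ℤ/(N/M₀)ℤ)`, in general the last arc absorbs the remainder — and, by
   the BLOCK COMPARISON `(k, j) ↦ M₀k + j` (`blockMap`, injective into `Fin N`; `dist(c − (M₀k+j)) ≤ dist(c − M₀k) + j`),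
   the sparse row sum `Σ_k e^{−(b/M₀)·dist(c − M₀k, Nℤ)} ≤ 1 + 2e^{2b}/b` (`sparseSum1_le`, via `torusSum1_le` at rate
   `b/M₀` and `(1 − e^{−x})⁻¹ ≤ eˣ/x`) and the sparse count `#{k : dist(x − M₀k, Nℤ) ≤ c̄M₀} ≤ 2c̄ + 3`
   (`sparseCount1_le`) — constants free of `N` and `M₀`;
§2 the torus `Π_i ℤ/N_iℤ` (sup distance): ball counts `≤ (2⌊r⌋ + 1)^d` (`ballCard_le`), the centres
   `Ctr N M₀ = Π_i Fin (nC (N i) M₀)`, `ctr k = (M₀k_i)_i`, cover multiplicity `≤ (2c̄ + 3)^d` (`coverMult_le`) and cover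
   row sums `Σ_{k′} e^{−(a/M₀)|ctr k − ctr k′|} ≤ (1 + 2e^{2a/d}d/a)^d` (`coverRowSum_le`; at the printed rate `(2M₀)⁻¹`:
   `(1 + 4d·e^{1/d})^d`, `coverRowSum_half_le`), all by the coordinatewise factorisation of `torusSum_le`;
§3 unit-lattice row sums in the binder shapes of the chain: over any finite set of torus sites (`rowSum_finset_le`,
   `Λ(κ) = B4Sect5Proof.latticeConst d κ`), over any site type charted injectively into a torus with
   `tdist ∘ e ≤ dist` (`Chart`, `rowSum_chart_le`, `ballCard_chart_le`), hence `URow` for one carrier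
   (`uRow_of_chart`) and the family forms `hRowU` / `hRow` of `B5Global115.S2_via132` / `global_of_prop12` for any
   family charted into tori of one dimension `d` (`hRowU_of_charts`, `hRow_of_charts`);
§4 the unit torus as a (pseudo)metric space `UT N` (a type synonym of `TSite d N` with `dist = tdist`), on which §2
   reads LITERALLY as the fields `hν`, `hrow` of `B5Local114.Realisation` with `X := UT N`, `S := Ctr N M₀`,
   `ctr := ctrU N M₀`, `κ.nu := (2c̄+3)^d`, `κ.Kbar := (1 + 4d·e^{1/d})^d` (`hnu_holds`, `hrow_holds`), and the site
   dictionary `hdist` for a chart with `dist = tdist ∘ e` (`hdist_holds`).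

METRIC.  `tdist` is the SUP (ℓ^∞) circular distance on `Π_i ℤ/N_iℤ`, the paper's `|y − y′|` is Euclidean; since
`|x|_∞ ≤ |x| ≤ √d·|x|_∞`, every multiplicity / ball-count / row-sum bound below DOMINATES its Euclidean counterpart (the
charts of §3 accept any distance `ρ ≥ tdist ∘ e`, in particular the Euclidean torus distance), while a decay statement
phrased in `dist` of `UT N` is the printed Euclidean decay up to the factor `√d` in the rate (constants only; cell
DIVERGENCE D-b05g5.1, together with the truncated cover for `M₀ ∤ N_i`).

WHAT IT DOES NOT GIVE.  The analytic fields of `Realisation` (`G = Δ_a⁻¹` on `L²(T_η)`, the partition of unity `h_z`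
with (1.118) and (1.128), the certificates (1.125)/(1.129)/(1.130), (1.89)), the piece / cut-off / Hölder fields of
`GlobCover`, `CarrierFacts`, `PieceFacts132` — i.e. everything that needs the `L²(T_η)` operator calculus (surge node
T02.1 territory) — and any statement of B5 itself.  Unit `b2b-balaban-b05-g5` (PAPER SUB-CELL B05 gen 5; journal claim
SHARPEN T02.2(j) TORUS-COVER-GEOMETRY); census C-B5-27 (GAPS.md); DIVERGENCE D-b05g5.1 (sup metric; truncated cover for
`M₀ ∤ N_i`).  Value = kernel certificate of located geometric leaves, NOT summit progress.
-/

open Finset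

namespace Literature.MathematicalPhysics.QuantumFieldTheory.Balaban1983to89.B5TorusCover

open B4TorusKernel.MultiPeriod (circAbs centre circAbs_nonneg circAbs_le_abs circAbs_add_mul abs_add_mul_centre)
open B4Sect5Torus (TSite ccoord tdist tdist_symm tdist_self tdist_triangle tdist_nonneg circAbs_le_tdist
  circAbs_add_le torusSum1_le torusSum_le)

noncomputable section

/-! ## §0  Two real-analysis one-liners -/

/-- `(1 − e^{−x})⁻¹ ≤ eˣ/x` for `x > 0` (from `1 + x ≤ eˣ`). [folklore] -/
theorem inv_one_sub_exp_neg_le {x : ℝ} (hx : 0 < x) : (1 - Real.exp (-x))⁻¹ ≤ Real.exp x / x := by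
  have h1 : 0 < 1 - Real.exp (-x) := by
    rw [sub_pos]
    exact Real.exp_lt_one_iff.mpr (by linarith)
  have key : x ≤ Real.exp x * (1 - Real.exp (-x)) := by
    rw [mul_sub, mul_one, ← Real.exp_add, add_neg_cancel, Real.exp_zero]
    linarith [Real.add_one_le_exp x]
  calc (1 - Real.exp (-x))⁻¹ = x⁻¹ * (x * (1 - Real.exp (-x))⁻¹) := by
        rw [← mul_assoc, inv_mul_cancel₀ hx.ne', one_mul]
    _ ≤ x⁻¹ * (Real.exp x * (1 - Real.exp (-x)) * (1 - Real.exp (-x))⁻¹) :=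
        mul_le_mul_of_nonneg_left (mul_le_mul_of_nonneg_right key (inv_nonneg.mpr h1.le)) (inv_nonneg.mpr hx.le)
    _ = Real.exp x / x := by
        rw [mul_inv_cancel_right₀ h1.ne', inv_mul_eq_div]

/-- `e^{−(nonneg)} ≤ 1`. [folklore] -/
theorem exp_neg_mul_le_one {a t : ℝ} (ha : 0 ≤ a) (ht : 0 ≤ t) : Real.exp (-(a * t)) ≤ 1 := by
  rw [Real.exp_le_one_iff, neg_nonpos]
  exact mul_nonneg ha ht

/-! ## §1  One circle `ℤ/Nℤ`: centred representatives, ball counts, the arc cover and the block comparison -/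

section Circle

variable {N : ℕ}

/-- The centred representative of `z mod N`: `z + N·centre N z ∈ [−N/2, N/2]`, of absolute value `circAbs N z`
(`B4TorusKernel.MultiPeriod.abs_add_mul_centre`). [folklore] -/
def crep (N : ℕ) (z : ℤ) : ℤ := z + N * centre N z

/-- `|crep N z| = dist(z, Nℤ)`. [folklore] -/
theorem abs_crep (hN : 1 ≤ N) (z : ℤ) : |crep N z| = circAbs N z := abs_add_mul_centre hN z

/-- `crep N z ≡ z (mod N)`. [folklore] -/
theorem crep_emod (N : ℕ) (z : ℤ) : crep N z % (N : ℤ) = z % (N : ℤ) := by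
  unfold crep
  exact Int.add_mul_emod_self_left _ _ _

/-- Distinct residues `t ∈ ℤ/Nℤ` have distinct centred representatives of `c − t`. [folklore] -/
theorem crep_sub_injective (N : ℕ) (c : ℤ) :
    Function.Injective fun t : Fin N => crep N (c - (t.val : ℤ)) := by
  intro t t' h
  have h' : crep N (c - (t.val : ℤ)) = crep N (c - (t'.val : ℤ)) := h
  have h1 : Int.ModEq (N : ℤ) (c - (t.val : ℤ)) (c - (t'.val : ℤ)) := by
    have h2 := congrArg (· % (N : ℤ)) h'
    simp only [crep_emod] at h2
    exact h2
  obtain ⟨k, hk⟩ := h1.dvd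
  have ht : (t.val : ℤ) < N := by exact_mod_cast t.isLt
  have ht' : (t'.val : ℤ) < N := by exact_mod_cast t'.isLt
  have h0 : (0 : ℤ) ≤ t.val := by positivity
  have h0' : (0 : ℤ) ≤ t'.val := by positivity
  have hk' : (t.val : ℤ) - (t'.val : ℤ) = N * k := by linarith
  have hk0 : k = 0 := by
    rcases lt_trichotomy k 0 with hk1 | hk1 | hk1
    · have : (N : ℤ) * k ≤ -N := by nlinarith
      linarith
    · exact hk1
    · have : (N : ℤ) ≤ N * k := by nlinarith
      linarith
  rw [hk0, mul_zero, sub_eq_zero] at hk'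
  exact Fin.ext (by exact_mod_cast hk')

/-- **Ball counts on one circle, uniformly in `N`**: `#{t ∈ ℤ/Nℤ : dist(c − t, Nℤ) ≤ R} ≤ 2⌊R⌋ + 1` (the centred
representatives are distinct integers in `[−R, R]`). [folklore] -/
theorem circBall_card_le (hN : 1 ≤ N) (c : ℤ) {R : ℝ} (hR : 0 ≤ R) :
    (Finset.univ.filter fun t : Fin N => (circAbs N (c - (t.val : ℤ)) : ℝ) ≤ R).card ≤ 2 * ⌊R⌋₊ + 1 := by
  set A := Finset.univ.filter fun t : Fin N => (circAbs N (c - (t.val : ℤ)) : ℝ) ≤ R with hA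
  have hmap : ∀ t ∈ A, crep N (c - (t.val : ℤ)) ∈ Finset.Icc (-(⌊R⌋₊ : ℤ)) (⌊R⌋₊ : ℤ) := by
    intro t ht
    rw [hA, Finset.mem_filter] at ht
    have h1 : |crep N (c - (t.val : ℤ))| = circAbs N (c - (t.val : ℤ)) := abs_crep hN _
    have h2 : ((Int.natAbs (crep N (c - (t.val : ℤ))) : ℕ) : ℝ) ≤ R := by
      rw [Nat.cast_natAbs, h1]
      exact ht.2
    have h5 : Int.natAbs (crep N (c - (t.val : ℤ))) ≤ ⌊R⌋₊ := (Nat.le_floor_iff hR).mpr h2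
    have h6 : |crep N (c - (t.val : ℤ))| ≤ (⌊R⌋₊ : ℤ) := by
      rw [← Int.natCast_natAbs]
      exact_mod_cast h5
    rw [Finset.mem_Icc]
    exact ⟨(abs_le.mp h6).1, (abs_le.mp h6).2⟩
  have hinj : Set.InjOn (fun t : Fin N => crep N (c - (t.val : ℤ))) ↑A :=
    Set.injOn_of_injective (crep_sub_injective N c)
  calc A.card ≤ (Finset.Icc (-(⌊R⌋₊ : ℤ)) (⌊R⌋₊ : ℤ)).card :=
        Finset.card_le_card_of_injOn _ (fun t ht => hmap t ht) hinj
    _ = 2 * ⌊R⌋₊ + 1 := by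
        rw [Int.card_Icc]
        omega

/-- One block step costs at most its length: `dist(c − (m + j), Nℤ) ≤ dist(c − m, Nℤ) + j`. [folklore] -/
theorem circAbs_block_le (hN : 1 ≤ N) (c : ℤ) (m j : ℕ) :
    circAbs N (c - ((m + j : ℕ) : ℤ)) ≤ circAbs N (c - (m : ℤ)) + j := by
  have h := circAbs_add_le hN (c - (m : ℤ)) (-(j : ℤ))
  have e : c - (m : ℤ) + -(j : ℤ) = c - ((m + j : ℕ) : ℤ) := by push_cast; ring
  rw [e] at h
  have h2 : circAbs N (-(j : ℤ)) ≤ (j : ℤ) := by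
    have := circAbs_le_abs hN (-(j : ℤ))
    rwa [abs_neg, abs_of_nonneg (by positivity : (0 : ℤ) ≤ j)] at this
  linarith

/-- **The arc cover of the circle at scale `M₀`**: the number of arcs, `max 1 ⌊N/M₀⌋` (for `M₀ | N` exactly `N/M₀`,
the printed centre lattice `T^{(k+m₀)}_{M₀}`; for `M₀ > N` a single arc). [cite: Balaban1984PropagatorsI, p.36 (the cubes □_z)] -/
def nC (N M₀ : ℕ) : ℕ := max 1 (N / M₀)

/-- At least one arc. [folklore] -/
theorem one_le_nC (N M₀ : ℕ) : 1 ≤ nC N M₀ := le_max_left _ _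

/-- The non-degenerate case. [folklore] -/
theorem nC_eq_div {N M₀ : ℕ} (h : 1 ≤ N / M₀) : nC N M₀ = N / M₀ := max_eq_right h

/-- The degenerate case `M₀ > N` (or `M₀ = 0`): one arc. [folklore] -/
theorem nC_eq_one {N M₀ : ℕ} (h : N / M₀ = 0) : nC N M₀ = 1 := by
  unfold nC
  rw [h]
  rfl

/-- The left end-points ("centres") `M₀k`, `k < nC N M₀`, are sites of `ℤ/Nℤ`. [folklore] -/
theorem ctr_lt (hN : 1 ≤ N) (M₀ : ℕ) (k : Fin (nC N M₀)) : M₀ * k.val < N := by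
  rcases Nat.eq_zero_or_pos (N / M₀) with h0 | hpos
  · have hk : k.val < 1 := k.isLt.trans_eq (nC_eq_one h0)
    have : k.val = 0 := by omega
    rw [this, mul_zero]
    omega
  · have hq : 1 ≤ N / M₀ := Nat.one_le_iff_ne_zero.mpr hpos.ne'
    have hk : k.val < N / M₀ := k.isLt.trans_eq (nC_eq_div hq)
    rcases Nat.eq_zero_or_pos M₀ with hM | hM
    · subst hM
      rw [zero_mul]
      omega
    · calc M₀ * k.val < M₀ * (N / M₀) := mul_lt_mul_of_pos_left hk hM
        _ ≤ N := by rw [mul_comm]; exact Nat.div_mul_le_self N M₀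

/-- In the non-degenerate case every full block `{M₀k + j : j < M₀}`, `k < N/M₀`, lies in `[0, N)`. [folklore] -/
theorem block_lt {N M₀ : ℕ} (hq : 1 ≤ N / M₀) (k : Fin (nC N M₀)) (j : Fin M₀) : j.val + M₀ * k.val < N := by
  have hk : k.val < N / M₀ := k.isLt.trans_eq (nC_eq_div hq)
  have h1 : k.val + 1 ≤ N / M₀ := hk
  have h2 : M₀ * (k.val + 1) ≤ M₀ * (N / M₀) := Nat.mul_le_mul_left _ h1
  have h3 : M₀ * (N / M₀) ≤ N := by rw [mul_comm]; exact Nat.div_mul_le_self N M₀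
  have hj := j.isLt
  have h4 : M₀ * (k.val + 1) = M₀ * k.val + M₀ := by ring
  omega

/-- The block map `(k, j) ↦ M₀k + j ∈ ℤ/Nℤ` (non-degenerate case). [folklore] -/
def blockMap {N M₀ : ℕ} (hq : 1 ≤ N / M₀) (p : Fin (nC N M₀) × Fin M₀) : Fin N :=
  ⟨p.2.val + M₀ * p.1.val, block_lt hq p.1 p.2⟩

/-- The value of the block map. [folklore] -/
theorem blockMap_val {N M₀ : ℕ} (hq : 1 ≤ N / M₀) (k : Fin (nC N M₀)) (j : Fin M₀) :
    ((blockMap hq (k, j)).val : ℤ) = ((M₀ * k.val + j.val : ℕ) : ℤ) := by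
  simp only [blockMap]
  push_cast
  ring

/-- The blocks are disjoint: the block map is injective (Euclidean division by `M₀`). [folklore] -/
theorem blockMap_injective {N M₀ : ℕ} (hq : 1 ≤ N / M₀) : Function.Injective (blockMap hq) := by
  rintro ⟨k, j⟩ ⟨k', j'⟩ h
  have hM : 0 < M₀ := by
    rcases Nat.eq_zero_or_pos M₀ with h0 | h0
    · exfalso
      subst h0
      simp at hq
    · exact h0
  have h' : j.val + M₀ * k.val = j'.val + M₀ * k'.val := by
    have := congrArg Fin.val h
    simpa [blockMap] using this
  have hk : k.val = k'.val := by
    have h1 : (j.val + M₀ * k.val) / M₀ = (j'.val + M₀ * k'.val) / M₀ := by rw [h']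
    rwa [Nat.add_mul_div_left _ _ hM, Nat.add_mul_div_left _ _ hM, Nat.div_eq_of_lt j.isLt,
      Nat.div_eq_of_lt j'.isLt, zero_add, zero_add] at h1
  have hj : j.val = j'.val := by
    have h1 : (j.val + M₀ * k.val) % M₀ = (j'.val + M₀ * k'.val) % M₀ := by rw [h']
    rwa [Nat.add_mul_mod_self_left, Nat.add_mul_mod_self_left, Nat.mod_eq_of_lt j.isLt,
      Nat.mod_eq_of_lt j'.isLt] at h1
  exact Prod.ext (Fin.ext hk) (Fin.ext hj)

/-- **Sparse row sums on one circle, uniformly in `N ≥ 1` and `M₀ ≥ 1`**: for every centre `c` and rate `b > 0`,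
`Σ_{k < nC N M₀} e^{−(b/M₀)·dist(c − M₀k, Nℤ)} ≤ 1 + 2e^{2b}/b`.  Proof: each term is at most `e^b/M₀` times the sum of
`e^{−(b/M₀)·dist(c − t, Nℤ)}` over its block (`circAbs_block_le`); the blocks are disjoint (`blockMap_injective`), so
the total is `≤ (e^b/M₀)·Σ_{t∈ℤ/Nℤ} e^{−(b/M₀)dist(c−t,Nℤ)} ≤ (e^b/M₀)·2(1 − e^{−b/M₀})⁻¹ ≤ 2e^{2b}/b`
(`torusSum1_le`, `inv_one_sub_exp_neg_le`); the degenerate case has one term `≤ 1`.  This is the uniformity behind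
the printed «Σ_{x∈Z^d} e^{−δ₀M₀|x|}» of (1.131) with `δ₀M₀ = ½` (one coordinate). [cite: Balaban1984PropagatorsI, (1.131) p.38] -/
theorem sparseSum1_le (hN : 1 ≤ N) {M₀ : ℕ} (hM : 1 ≤ M₀) (c : ℤ) {b : ℝ} (hb : 0 < b) :
    ∑ k : Fin (nC N M₀), Real.exp (-(b / M₀ * (circAbs N (c - ((M₀ * k.val : ℕ) : ℤ)) : ℝ)))
      ≤ 1 + 2 * Real.exp (2 * b) / b := by
  have hM0 : (0 : ℝ) < M₀ := by exact_mod_cast hM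
  have hM0' : (M₀ : ℝ) ≠ 0 := hM0.ne'
  have hb' : b ≠ 0 := hb.ne'
  have hbM : 0 < b / M₀ := div_pos hb hM0
  have hpos2 : 0 ≤ 2 * Real.exp (2 * b) / b := by positivity
  have hterm1 : ∀ k : Fin (nC N M₀),
      Real.exp (-(b / M₀ * (circAbs N (c - ((M₀ * k.val : ℕ) : ℤ)) : ℝ))) ≤ 1 :=
    fun k => exp_neg_mul_le_one hbM.le (by exact_mod_cast circAbs_nonneg hN _)
  rcases Nat.eq_zero_or_pos (N / M₀) with h0 | hq0
  · -- one arc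
    have hcard : Fintype.card (Fin (nC N M₀)) = 1 := by rw [Fintype.card_fin, nC_eq_one h0]
    calc ∑ k : Fin (nC N M₀), Real.exp (-(b / M₀ * (circAbs N (c - ((M₀ * k.val : ℕ) : ℤ)) : ℝ)))
        ≤ ∑ _k : Fin (nC N M₀), (1 : ℝ) := Finset.sum_le_sum fun k _ => hterm1 k
      _ = 1 := by rw [Finset.sum_const, Finset.card_univ, hcard]; simp
      _ ≤ 1 + 2 * Real.exp (2 * b) / b := le_add_of_nonneg_right hpos2
  · -- the block comparison
    have hq : 1 ≤ N / M₀ := Nat.one_le_iff_ne_zero.mpr hq0.ne'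
    set g : Fin N → ℝ := fun t => Real.exp (-(b / M₀ * (circAbs N (c - (t.val : ℤ)) : ℝ))) with hg
    have hg0 : ∀ t, 0 ≤ g t := fun t => (Real.exp_pos _).le
    have hblock : ∀ (k : Fin (nC N M₀)) (j : Fin M₀),
        Real.exp (-(b / M₀ * (circAbs N (c - ((M₀ * k.val : ℕ) : ℤ)) : ℝ)))
          ≤ Real.exp b * g (blockMap hq (k, j)) := by
      intro k j
      have h1 : circAbs N (c - ((M₀ * k.val + j.val : ℕ) : ℤ)) ≤
          circAbs N (c - ((M₀ * k.val : ℕ) : ℤ)) + j.val := circAbs_block_le hN c (M₀ * k.val) j.val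
      have h1' : (circAbs N (c - ((M₀ * k.val + j.val : ℕ) : ℤ)) : ℝ) ≤
          (circAbs N (c - ((M₀ * k.val : ℕ) : ℤ)) : ℝ) + j.val := by exact_mod_cast h1
      have h2 : (j.val : ℝ) ≤ M₀ := by exact_mod_cast j.isLt.le
      have h4 : b / M₀ * (M₀ : ℝ) = b := div_mul_cancel₀ b hM0'
      rw [hg]
      simp only []
      rw [blockMap_val hq k j, ← Real.exp_add]
      apply Real.exp_le_exp.mpr
      have h3 : b / M₀ * (circAbs N (c - ((M₀ * k.val + j.val : ℕ) : ℤ)) : ℝ) ≤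
          b / M₀ * (circAbs N (c - ((M₀ * k.val : ℕ) : ℤ)) : ℝ) + b := by
        have h5 : b / M₀ * (circAbs N (c - ((M₀ * k.val + j.val : ℕ) : ℤ)) : ℝ) ≤
            b / M₀ * ((circAbs N (c - ((M₀ * k.val : ℕ) : ℤ)) : ℝ) + M₀) :=
          mul_le_mul_of_nonneg_left (by linarith) hbM.le
        rw [mul_add, h4] at h5
        exact h5
      linarith
    have hsumj : ∀ k : Fin (nC N M₀),
        Real.exp (-(b / M₀ * (circAbs N (c - ((M₀ * k.val : ℕ) : ℤ)) : ℝ)))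
          ≤ ((M₀ : ℝ)⁻¹ * Real.exp b) * ∑ j : Fin M₀, g (blockMap hq (k, j)) := by
      intro k
      have h1 : ∑ _j : Fin M₀, Real.exp (-(b / M₀ * (circAbs N (c - ((M₀ * k.val : ℕ) : ℤ)) : ℝ)))
          ≤ ∑ j : Fin M₀, Real.exp b * g (blockMap hq (k, j)) := Finset.sum_le_sum fun j _ => hblock k j
      rw [Finset.sum_const, Finset.card_univ, Fintype.card_fin, nsmul_eq_mul, ← Finset.mul_sum] at h1
      rw [mul_assoc, inv_mul_eq_div, le_div_iff₀ hM0, mul_comm]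
      exact h1
    calc ∑ k : Fin (nC N M₀), Real.exp (-(b / M₀ * (circAbs N (c - ((M₀ * k.val : ℕ) : ℤ)) : ℝ)))
        ≤ ∑ k : Fin (nC N M₀), ((M₀ : ℝ)⁻¹ * Real.exp b) * ∑ j : Fin M₀, g (blockMap hq (k, j)) :=
          Finset.sum_le_sum fun k _ => hsumj k
      _ = ((M₀ : ℝ)⁻¹ * Real.exp b) * ∑ p : Fin (nC N M₀) × Fin M₀, g (blockMap hq p) := by
          rw [← Finset.mul_sum, Fintype.sum_prod_type]
      _ ≤ ((M₀ : ℝ)⁻¹ * Real.exp b) * ∑ t : Fin N, g t := by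
          apply mul_le_mul_of_nonneg_left _ (by positivity)
          calc ∑ p : Fin (nC N M₀) × Fin M₀, g (blockMap hq p)
              = ∑ t ∈ Finset.univ.image (blockMap hq), g t :=
                (Finset.sum_image (f := g) fun p _ q _ h => blockMap_injective hq h).symm
            _ ≤ ∑ t, g t :=
                Finset.sum_le_sum_of_subset_of_nonneg (Finset.subset_univ _) fun t _ _ => hg0 t
      _ ≤ ((M₀ : ℝ)⁻¹ * Real.exp b) * (2 * (1 - Real.exp (-(b / M₀)))⁻¹) := by
          apply mul_le_mul_of_nonneg_left _ (by positivity)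
          exact torusSum1_le hN c hbM
      _ ≤ ((M₀ : ℝ)⁻¹ * Real.exp b) * (2 * (Real.exp (b / M₀) / (b / M₀))) := by
          apply mul_le_mul_of_nonneg_left _ (by positivity)
          exact mul_le_mul_of_nonneg_left (inv_one_sub_exp_neg_le hbM) (by norm_num)
      _ = 2 * (Real.exp b * Real.exp (b / M₀)) / b := by
          field_simp
      _ ≤ 2 * Real.exp (2 * b) / b := by
          apply div_le_div_of_nonneg_right _ hb.le
          apply mul_le_mul_of_nonneg_left _ (by norm_num)
          rw [← Real.exp_add]
          apply Real.exp_le_exp.mpr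
          have : b / M₀ ≤ b := div_le_self hb.le (by exact_mod_cast hM)
          linarith
      _ ≤ 1 + 2 * Real.exp (2 * b) / b := le_add_of_nonneg_left zero_le_one

/-- **Sparse counts on one circle, uniformly in `N ≥ 1` and `M₀ ≥ 1`**: `#{k < nC N M₀ : dist(x − M₀k, Nℤ) ≤ c̄M₀}
≤ 2c̄ + 3`.  Proof: the blocks of the counted `k` are disjoint and lie in the ball of radius `c̄M₀ + M₀` about `x`,
which has at most `2(c̄M₀ + M₀) + 1` points (`circBall_card_le`). [cite: Balaban1984PropagatorsI, p.36 (the cubes □_z cover T_η)] -/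
theorem sparseCount1_le (hN : 1 ≤ N) {M₀ : ℕ} (hM : 1 ≤ M₀) (x : ℤ) {cbar : ℝ} (hc : 0 ≤ cbar) :
    (((Finset.univ.filter fun k : Fin (nC N M₀) =>
        (circAbs N (x - ((M₀ * k.val : ℕ) : ℤ)) : ℝ) ≤ cbar * M₀).card : ℕ) : ℝ) ≤ 2 * cbar + 3 := by
  set A := Finset.univ.filter fun k : Fin (nC N M₀) =>
    (circAbs N (x - ((M₀ * k.val : ℕ) : ℤ)) : ℝ) ≤ cbar * M₀ with hA
  rcases Nat.eq_zero_or_pos (N / M₀) with h0 | hq0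
  · have h1 : A.card ≤ 1 := by
      calc A.card ≤ (Finset.univ : Finset (Fin (nC N M₀))).card := Finset.card_le_card (Finset.filter_subset _ _)
        _ = 1 := by rw [Finset.card_univ, Fintype.card_fin, nC_eq_one h0]
    have h2 : (A.card : ℝ) ≤ 1 := by exact_mod_cast h1
    linarith
  · have hq : 1 ≤ N / M₀ := Nat.one_le_iff_ne_zero.mpr hq0.ne'
    have hM0 : (0 : ℝ) < M₀ := by exact_mod_cast hM
    have hM1 : (1 : ℝ) ≤ M₀ := by exact_mod_cast hM
    set R : ℝ := cbar * M₀ with hR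
    have hR0 : 0 ≤ R := by positivity
    set B := Finset.univ.filter fun t : Fin N => (circAbs N (x - (t.val : ℤ)) : ℝ) ≤ R + M₀ with hB
    have hBcard : B.card ≤ 2 * ⌊R + M₀⌋₊ + 1 := circBall_card_le hN x (by positivity)
    have hmaps : ∀ p ∈ A ×ˢ (Finset.univ : Finset (Fin M₀)), blockMap hq p ∈ B := by
      rintro ⟨k, j⟩ hp
      rw [Finset.mem_product] at hp
      have hk := (Finset.mem_filter.mp hp.1).2
      rw [hB, Finset.mem_filter]
      refine ⟨Finset.mem_univ _, ?_⟩
      have h1 := circAbs_block_le hN x (M₀ * k.val) j.val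
      have h1' : (circAbs N (x - ((M₀ * k.val + j.val : ℕ) : ℤ)) : ℝ) ≤
          (circAbs N (x - ((M₀ * k.val : ℕ) : ℤ)) : ℝ) + j.val := by exact_mod_cast h1
      have h2 : (j.val : ℝ) ≤ M₀ := by exact_mod_cast j.isLt.le
      rw [blockMap_val hq k j]
      linarith
    have hinj : Set.InjOn (blockMap hq) ↑(A ×ˢ (Finset.univ : Finset (Fin M₀))) :=
      Set.injOn_of_injective (blockMap_injective hq)
    have hcard : (A ×ˢ (Finset.univ : Finset (Fin M₀))).card ≤ B.card :=
      Finset.card_le_card_of_injOn _ (fun p hp => hmaps p hp) hinj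
    rw [Finset.card_product, Finset.card_univ, Fintype.card_fin] at hcard
    have h3 : (A.card : ℝ) * M₀ ≤ 2 * (R + M₀) + 1 := by
      have h4 : ((A.card * M₀ : ℕ) : ℝ) ≤ ((2 * ⌊R + M₀⌋₊ + 1 : ℕ) : ℝ) := by
        exact_mod_cast hcard.trans hBcard
      have h5 : (⌊R + M₀⌋₊ : ℝ) ≤ R + M₀ := Nat.floor_le (by positivity)
      push_cast at h4
      linarith
    have h6 : (A.card : ℝ) ≤ (2 * (R + M₀) + 1) / M₀ := by
      rw [le_div_iff₀ hM0]
      exact h3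
    have h7 : (2 * (R + M₀) + 1) / M₀ ≤ 2 * cbar + 3 := by
      rw [div_le_iff₀ hM0, hR]
      nlinarith
    linarith

end Circle

/-! ## §2  The torus `Π_i ℤ/N_iℤ` with the sup distance: ball counts, the cube cover, multiplicity and row sums -/

section Torus

variable {d : ℕ} {N : Fin d → ℕ}

/-- A sup-ball is contained in the product of the coordinate balls. [folklore] -/
theorem ball_subset_pi (hN : ∀ i, 1 ≤ N i) (y : TSite d N) (r : ℝ) :
    (Finset.univ.filter fun w : TSite d N => tdist N y w ≤ r) ⊆
      Fintype.piFinset fun i => Finset.univ.filter fun t : Fin (N i) =>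
        (circAbs (N i) (((y i).val : ℤ) - (t.val : ℤ)) : ℝ) ≤ r := by
  intro w hw
  rw [Fintype.mem_piFinset]
  intro i
  rw [Finset.mem_filter]
  exact ⟨Finset.mem_univ _, (circAbs_le_tdist hN y w i).trans (Finset.mem_filter.mp hw).2⟩

/-- **Ball counts on the torus, uniformly in the periods**: `#{w : tdist(y, w) ≤ r} ≤ (2⌊r⌋ + 1)^d` — the shape of
`CarrierFacts.nbr_card` / `MapFacts.nbr_card` with `nbr y` = the ball of radius `r0`. [folklore] -/
theorem ballCard_le (hN : ∀ i, 1 ≤ N i) (y : TSite d N) {r : ℝ} (hr : 0 ≤ r) :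
    (Finset.univ.filter fun w : TSite d N => tdist N y w ≤ r).card ≤ (2 * ⌊r⌋₊ + 1) ^ d := by
  calc (Finset.univ.filter fun w : TSite d N => tdist N y w ≤ r).card
      ≤ (Fintype.piFinset fun i => Finset.univ.filter fun t : Fin (N i) =>
          (circAbs (N i) (((y i).val : ℤ) - (t.val : ℤ)) : ℝ) ≤ r).card :=
        Finset.card_le_card (ball_subset_pi hN y r)
    _ = ∏ i, (Finset.univ.filter fun t : Fin (N i) =>
          (circAbs (N i) (((y i).val : ℤ) - (t.val : ℤ)) : ℝ) ≤ r).card := Fintype.card_piFinset _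
    _ ≤ ∏ _i : Fin d, (2 * ⌊r⌋₊ + 1) := by
        apply Finset.prod_le_prod
        · intro i _
          exact Nat.zero_le _
        · intro i _
          exact circBall_card_le (hN i) _ hr
    _ = (2 * ⌊r⌋₊ + 1) ^ d := by rw [Finset.prod_const, Finset.card_univ, Fintype.card_fin]

/-- Ball counts, real-valued form (the constant `Nn` of the carrier facts is a real number). [folklore] -/
theorem ballCard_le_real (hN : ∀ i, 1 ≤ N i) (y : TSite d N) {r : ℝ} (hr : 0 ≤ r) :
    ((Finset.univ.filter fun w : TSite d N => tdist N y w ≤ r).card : ℝ) ≤ (2 * ⌊r⌋₊ + 1 : ℝ) ^ d := by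
  have := ballCard_le hN y hr
  exact_mod_cast this

/-- **The centres of the cube cover at scale `M₀`**: one arc index per coordinate. [cite: Balaban1984PropagatorsI, p.36 (the lattice T^{(k+m₀)}_{M₀})] -/
abbrev Ctr (N : Fin d → ℕ) (M₀ : ℕ) : Type := (i : Fin d) → Fin (nC (N i) M₀)

/-- The centre `z = (M₀k_i)_i` of the cube with index `k`, as a site of the unit torus. [cite: Balaban1984PropagatorsI, p.36 (the point z ∈ T^{(k+m₀)}_{M₀})] -/
def ctr (hN : ∀ i, 1 ≤ N i) (M₀ : ℕ) (k : Ctr N M₀) : TSite d N :=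
  fun i => ⟨M₀ * (k i).val, ctr_lt (hN i) M₀ (k i)⟩

/-- The coordinates of a centre. [folklore] -/
theorem ctr_val (hN : ∀ i, 1 ≤ N i) (M₀ : ℕ) (k : Ctr N M₀) (i : Fin d) :
    (((ctr hN M₀ k i).val : ℕ) : ℤ) = ((M₀ * (k i).val : ℕ) : ℤ) := rfl

/-- **Cover multiplicity, uniformly in the torus and in `M₀ ≥ 1`**: every site is within sup-distance `c̄M₀` of at
most `(2c̄ + 3)^d` centres — the number `ν` of `B5Local114.Realisation.hν` / `B5Walk131.walkSum_le`
(«these cubes cover the lattice T_η», p. 36; in `Z^d`, `B5Walk131.card_cubes_containing_le`). [cite: Balaban1984PropagatorsI, p.36] -/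
theorem coverMult_le (hN : ∀ i, 1 ≤ N i) {M₀ : ℕ} (hM : 1 ≤ M₀) {cbar : ℝ} (hc : 0 ≤ cbar) (x : TSite d N) :
    (((Finset.univ.filter fun k : Ctr N M₀ => tdist N x (ctr hN M₀ k) ≤ cbar * M₀).card : ℕ) : ℝ)
      ≤ (2 * cbar + 3) ^ d := by
  set A := Finset.univ.filter fun k : Ctr N M₀ => tdist N x (ctr hN M₀ k) ≤ cbar * M₀ with hA
  set Ai : (i : Fin d) → Finset (Fin (nC (N i) M₀)) := fun i =>
    Finset.univ.filter fun t : Fin (nC (N i) M₀) =>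
      (circAbs (N i) (((x i).val : ℤ) - ((M₀ * t.val : ℕ) : ℤ)) : ℝ) ≤ cbar * M₀ with hAi
  have hsub : A ⊆ Fintype.piFinset Ai := by
    intro k hk
    rw [Fintype.mem_piFinset]
    intro i
    have hk' := (Finset.mem_filter.mp hk).2
    rw [hAi, Finset.mem_filter]
    refine ⟨Finset.mem_univ _, ?_⟩
    have h1 := circAbs_le_tdist hN x (ctr hN M₀ k) i
    rw [ctr_val hN M₀ k i] at h1
    exact h1.trans hk'
  calc (A.card : ℝ) ≤ ((Fintype.piFinset Ai).card : ℝ) := by exact_mod_cast Finset.card_le_card hsub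
    _ = ∏ i, ((Ai i).card : ℝ) := by rw [Fintype.card_piFinset]; push_cast; rfl
    _ ≤ ∏ _i : Fin d, (2 * cbar + 3) := by
        apply Finset.prod_le_prod
        · intro i _
          positivity
        · intro i _
          exact sparseCount1_le (hN i) hM _ hc
    _ = (2 * cbar + 3) ^ d := by rw [Finset.prod_const, Finset.card_univ, Fintype.card_fin]

/-- **Cover row sums, uniformly in the torus and in `M₀ ≥ 1`**: for every rate `a > 0`,
`Σ_{k′} e^{−(a/M₀)·tdist(ctr k, ctr k′)} ≤ (1 + 2e^{2a/d}·d/a)^d` (coordinatewise factorisation as in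
`B4Sect5Torus.torusSum_le`, then `sparseSum1_le` at rate `a/d` in each coordinate). [cite: Balaban1984PropagatorsI, (1.131) p.38] -/
theorem coverRowSum_le (hN : ∀ i, 1 ≤ N i) {M₀ : ℕ} (hM : 1 ≤ M₀) {a : ℝ} (ha : 0 < a) (k : Ctr N M₀) :
    ∑ k' : Ctr N M₀, Real.exp (-(a / M₀ * tdist N (ctr hN M₀ k) (ctr hN M₀ k')))
      ≤ (1 + 2 * Real.exp (2 * (a / d)) / (a / d)) ^ d := by
  have hM0 : (0 : ℝ) < M₀ := by exact_mod_cast hM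
  set x := ctr hN M₀ k with hx
  have hcoord : ∀ k' : Ctr N M₀, Real.exp (-(a / M₀ * tdist N x (ctr hN M₀ k'))) ≤
      ∏ i, Real.exp (-(a / d / M₀ *
        (circAbs (N i) (((x i).val : ℤ) - ((M₀ * (k' i).val : ℕ) : ℤ)) : ℝ))) := by
    intro k'
    rw [← Real.exp_sum]
    apply Real.exp_le_exp.mpr
    have hsum : ∑ i : Fin d, a / d / M₀ * (circAbs (N i) (((x i).val : ℤ) - ((M₀ * (k' i).val : ℕ) : ℤ)) : ℝ)
        ≤ a / M₀ * tdist N x (ctr hN M₀ k') := by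
      calc ∑ i : Fin d, a / d / M₀ * (circAbs (N i) (((x i).val : ℤ) - ((M₀ * (k' i).val : ℕ) : ℤ)) : ℝ)
          ≤ ∑ _i : Fin d, a / d / M₀ * tdist N x (ctr hN M₀ k') := by
            apply Finset.sum_le_sum
            intro i _
            apply mul_le_mul_of_nonneg_left _ (by positivity)
            have h1 := circAbs_le_tdist hN x (ctr hN M₀ k') i
            rw [ctr_val hN M₀ k' i] at h1
            exact h1
        _ = (d : ℝ) * (a / d / M₀ * tdist N x (ctr hN M₀ k')) := by
            rw [Finset.sum_const, Finset.card_univ, Fintype.card_fin, nsmul_eq_mul]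
        _ ≤ a / M₀ * tdist N x (ctr hN M₀ k') := by
            rcases Nat.eq_zero_or_pos d with h0 | hpos
            · subst h0
              rw [Nat.cast_zero, zero_mul]
              exact mul_nonneg (div_pos ha hM0).le (tdist_nonneg N x _)
            · have hd : (d : ℝ) ≠ 0 := by exact_mod_cast hpos.ne'
              rw [show (d : ℝ) * (a / d / M₀ * tdist N x (ctr hN M₀ k')) = a / M₀ * tdist N x (ctr hN M₀ k') by
                field_simp]
    rw [Finset.sum_neg_distrib]
    linarith
  calc ∑ k' : Ctr N M₀, Real.exp (-(a / M₀ * tdist N x (ctr hN M₀ k')))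
      ≤ ∑ k' : Ctr N M₀, ∏ i, Real.exp (-(a / d / M₀ *
          (circAbs (N i) (((x i).val : ℤ) - ((M₀ * (k' i).val : ℕ) : ℤ)) : ℝ))) :=
        Finset.sum_le_sum fun k' _ => hcoord k'
    _ = ∏ i : Fin d, ∑ t : Fin (nC (N i) M₀), Real.exp (-(a / d / M₀ *
          (circAbs (N i) (((x i).val : ℤ) - ((M₀ * t.val : ℕ) : ℤ)) : ℝ))) :=
        (Fintype.prod_sum (fun i (t : Fin (nC (N i) M₀)) => Real.exp (-(a / d / M₀ *
          (circAbs (N i) (((x i).val : ℤ) - ((M₀ * t.val : ℕ) : ℤ)) : ℝ))))).symm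
    _ ≤ ∏ _i : Fin d, (1 + 2 * Real.exp (2 * (a / d)) / (a / d)) := by
        apply Finset.prod_le_prod
        · intro i _
          exact Finset.sum_nonneg fun t _ => (Real.exp_pos _).le
        · intro i _
          have hd : 0 < (d : ℝ) := by exact_mod_cast Fin.pos i
          exact sparseSum1_le (hN i) hM ((x i).val : ℤ) (div_pos ha hd)
    _ = (1 + 2 * Real.exp (2 * (a / d)) / (a / d)) ^ d := by
        rw [Finset.prod_const, Finset.card_univ, Fintype.card_fin]

/-- **Cover row sums at the printed rate `(2M₀)⁻¹`** (`2δ₀ = M₀⁻¹` at the chosen `M₀`, `B5Walk131.twoDelta0_eq_inv`):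
`Σ_{k′} e^{−tdist(ctr k, ctr k′)/(2M₀)} ≤ (1 + 4d·e^{1/d})^d` — the number `K̄` of `B5Local114.Realisation.hrow`,
free of the torus and of `M₀`. [cite: Balaban1984PropagatorsI, (1.131) p.38, p.39 («we can fix M₀ depending on d only»)] -/
theorem coverRowSum_half_le (hN : ∀ i, 1 ≤ N i) {M₀ : ℕ} (hM : 1 ≤ M₀) (k : Ctr N M₀) :
    ∑ k' : Ctr N M₀, Real.exp (-((2 * (M₀ : ℝ))⁻¹ * tdist N (ctr hN M₀ k) (ctr hN M₀ k')))
      ≤ (1 + 4 * d * Real.exp (1 / d)) ^ d := by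
  have h := coverRowSum_le hN hM (show (0 : ℝ) < 1 / 2 by norm_num) k
  have e1 : ∀ k' : Ctr N M₀, Real.exp (-((2 * (M₀ : ℝ))⁻¹ * tdist N (ctr hN M₀ k) (ctr hN M₀ k')))
      = Real.exp (-(1 / 2 / (M₀ : ℝ) * tdist N (ctr hN M₀ k) (ctr hN M₀ k'))) := by
    intro k'
    rw [show (2 * (M₀ : ℝ))⁻¹ = 1 / 2 / (M₀ : ℝ) by ring]
  rw [Finset.sum_congr rfl fun k' _ => e1 k']
  refine h.trans (le_of_eq ?_)
  rcases Nat.eq_zero_or_pos d with h0 | hpos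
  · subst h0
    simp
  · have hd : (d : ℝ) ≠ 0 := by exact_mod_cast hpos.ne'
    rw [show (2 : ℝ) * (1 / 2 / d) = 1 / d by ring]
    congr 1
    have : 2 * Real.exp (1 / d) / (1 / 2 / (d : ℝ)) = 4 * d * Real.exp (1 / d) := by
      field_simp
      ring
    rw [this]

end Torus

/-! ## §3  Unit-lattice row sums and ball counts in the binder shapes of the chain -/

section RowSums

variable {d : ℕ} {N : Fin d → ℕ}

/-- Row sums over any finite set of torus sites: `Σ_{y′∈T} e^{−κ·tdist(y,y′)} ≤ Λ(κ) = K_d(κ)` uniformly in the periods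
(`B4Sect5Torus.torusSum_le`). [folklore] -/
theorem rowSum_finset_le (hN : ∀ i, 1 ≤ N i) {κ : ℝ} (hκ : 0 < κ) (T : Finset (TSite d N)) (y : TSite d N) :
    ∑ y' ∈ T, Real.exp (-(κ * tdist N y y')) ≤ B4Sect5Proof.latticeConst d κ :=
  (Finset.sum_le_sum_of_subset_of_nonneg (Finset.subset_univ T) (fun _ _ _ => (Real.exp_pos _).le)).trans
    (torusSum_le d hN hκ y)

/-- **A torus chart of an abstract site type with a distance `ρ`**: an injection into a torus `Π_i ℤ/N_iℤ` under which
`ρ` dominates the sup torus distance (in the model: `ρ = tdist ∘ e`, the unit lattice `T₁^{(k)}` IS such a torus).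
[folklore] -/
structure Chart (Site : Type*) (ρ : Site → Site → ℝ) (d : ℕ) where
  N : Fin d → ℕ
  hN : ∀ i, 1 ≤ N i
  e : Site → TSite d N
  inj : Function.Injective e
  le : ∀ y y' : Site, tdist N (e y) (e y') ≤ ρ y y'

variable {Site : Type*} {ρ : Site → Site → ℝ}

/-- **Row sums through a chart**: `Σ_{y′∈T} e^{−κρ(y,y′)} ≤ K_d(κ)` for every finite `T`, uniformly. [folklore] -/
theorem rowSum_chart_le (C : Chart Site ρ d) {κ : ℝ} (hκ : 0 < κ) (T : Finset Site) (y : Site) :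
    ∑ y' ∈ T, Real.exp (-(κ * ρ y y')) ≤ B4Sect5Proof.latticeConst d κ := by
  classical
  calc ∑ y' ∈ T, Real.exp (-(κ * ρ y y'))
      ≤ ∑ y' ∈ T, Real.exp (-(κ * tdist C.N (C.e y) (C.e y'))) := by
        apply Finset.sum_le_sum
        intro y' _
        apply Real.exp_le_exp.mpr
        have := mul_le_mul_of_nonneg_left (C.le y y') hκ.le
        linarith
    _ = ∑ w ∈ T.image C.e, Real.exp (-(κ * tdist C.N (C.e y) w)) :=
        (Finset.sum_image (f := fun w => Real.exp (-(κ * tdist C.N (C.e y) w))) fun a _ b _ h => C.inj h).symm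
    _ ≤ B4Sect5Proof.latticeConst d κ := rowSum_finset_le C.hN hκ _ _

/-- **Ball counts through a chart** (finite site type): `#{w : ρ(y,w) ≤ r} ≤ (2⌊r⌋ + 1)^d`. [folklore] -/
theorem ballCard_chart_le [Fintype Site] (C : Chart Site ρ d) (y : Site) {r : ℝ} (hr : 0 ≤ r) :
    ((Finset.univ.filter fun w : Site => ρ y w ≤ r).card : ℝ) ≤ (2 * ⌊r⌋₊ + 1 : ℝ) ^ d := by
  classical
  have hmaps : ∀ w ∈ (Finset.univ.filter fun w : Site => ρ y w ≤ r),
      C.e w ∈ (Finset.univ.filter fun w' : TSite d C.N => tdist C.N (C.e y) w' ≤ r) := by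
    intro w hw
    rw [Finset.mem_filter] at hw ⊢
    exact ⟨Finset.mem_univ _, (C.le y w).trans hw.2⟩
  have h1 : (Finset.univ.filter fun w : Site => ρ y w ≤ r).card ≤
      (Finset.univ.filter fun w' : TSite d C.N => tdist C.N (C.e y) w' ≤ r).card :=
    Finset.card_le_card_of_injOn _ (fun w hw => hmaps w hw) (Set.injOn_of_injective C.inj)
  have h2 := ballCard_le C.hN (C.e y) hr
  exact_mod_cast h1.trans h2

/-- The canonical neighbourhoods `nbr y := {w : ρ(y, w) ≤ r0}` (a choice of the datum `nbr` of
`B5Transfer133.Carrier133`). [folklore] -/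
def nbrOf [Fintype Site] (ρ : Site → Site → ℝ) (r0 : ℝ) (y : Site) : Finset Site :=
  Finset.univ.filter fun w => ρ y w ≤ r0

/-- `nbr_dist` of `CarrierFacts` / `MapFacts` for the canonical neighbourhoods. [folklore] -/
theorem nbrOf_dist [Fintype Site] (r0 : ℝ) (y w : Site) (hw : w ∈ nbrOf ρ r0 y) : ρ y w ≤ r0 :=
  (Finset.mem_filter.mp hw).2

/-- `nbr_card` of `CarrierFacts` / `MapFacts` for the canonical neighbourhoods, with `Nn = (2⌊r0⌋ + 1)^d`, uniformly
over every site type charted into a `d`-torus. [folklore] -/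
theorem nbrOf_card [Fintype Site] (C : Chart Site ρ d) {r0 : ℝ} (hr : 0 ≤ r0) (y : Site) :
    ((nbrOf ρ r0 y).card : ℝ) ≤ (2 * ⌊r0⌋₊ + 1 : ℝ) ^ d :=
  ballCard_chart_le C y hr

/-- **`URow` for one carrier** (`B5Transfer133.URow K κ Λ := ∀ y, Σ_{y″∈K.T1} e^{−κ|y−y″|} ≤ Λ`): holds with
`Λ = K_d(κ)` whenever the estimated setting's sites are charted into a `d`-torus. [cite: Balaban1984PropagatorsI, (1.133) p.39] -/
theorem uRow_of_chart {S' S₀ : B5.Setting} (K : B5Transfer133.Carrier133 S' S₀) (C : Chart S₀.Site S₀.dist d)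
    {κ : ℝ} (hκ : 0 < κ) : B5Transfer133.URow K κ (B4Sect5Proof.latticeConst d κ) :=
  fun y => rowSum_chart_le C hκ K.T1 y

/-- **The family hypothesis `hRowU` of `B5Global115.S2_via132` / `B5Transfer132.prop12_of_G0_via132`**: for a family
of carriers whose estimated settings are charted into tori of one dimension `d`, `∀ κ > 0, ∃ Λ, ∀ i, URow (Kf i) κ Λ`.
[cite: Balaban1984PropagatorsI, (1.132)–(1.133) p.39] -/
theorem hRowU_of_charts {I : Type*} {famG0 fam : I → B5.Setting}
    (Kf : ∀ i, B5Transfer133.Carrier133 (famG0 i) (fam i)) (C : ∀ i, Chart (fam i).Site (fam i).dist d) :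
    ∀ κ : ℝ, 0 < κ → ∃ Λ : ℝ, ∀ i, B5Transfer133.URow (Kf i) κ Λ :=
  fun κ hκ => ⟨B4Sect5Proof.latticeConst d κ, fun i => uRow_of_chart (Kf i) (C i) hκ⟩

/-- **The family hypothesis `hRow` of `B5Global115.global_of_prop12` / `S2_via132` / `global_via132_walk`**: for any
finite sets `T i` (there: `(D i).T1` of the covers) of a family charted into tori of one dimension `d`,
`∀ κ > 0, ∃ Λ, ∀ i y, Σ_{y′∈T i} e^{−κ|y−y′|} ≤ Λ`. [cite: Balaban1984PropagatorsI, (1.115)–(1.117) p.36] -/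
theorem hRow_of_charts {I : Type*} {fam : I → B5.Setting} (C : ∀ i, Chart (fam i).Site (fam i).dist d)
    (T : ∀ i, Finset (fam i).Site) :
    ∀ κ : ℝ, 0 < κ → ∃ Λ : ℝ, ∀ (i : I) (y : (fam i).Site),
      ∑ y' ∈ T i, Real.exp (-(κ * (fam i).dist y y')) ≤ Λ :=
  fun κ hκ => ⟨B4Sect5Proof.latticeConst d κ, fun i y => rowSum_chart_le (C i) hκ (T i) y⟩

end RowSums

/-! ## §4  The unit torus as a pseudometric space; the fields `hν`, `hrow`, `hdist` of `B5Local114.Realisation` -/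

/-- The unit torus `Π_i ℤ/N_iℤ` as a carrier type with `dist = tdist` (a synonym of `B4Sect5Torus.TSite d N`; the
`X` of `B5Local114.Realisation` in the model). [folklore] -/
def UT {d : ℕ} (N : Fin d → ℕ) : Type := TSite d N

namespace UT

variable {d : ℕ} (N : Fin d → ℕ)

/-- All periods are `≥ 1`. [folklore] -/
theorem one_le [hN : ∀ i, NeZero (N i)] (i : Fin d) : 1 ≤ N i := Nat.one_le_iff_ne_zero.mpr (NeZero.ne _)

/-- A torus site as a point of the carrier. [folklore] -/
def ofSite (x : TSite d N) : UT N := x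

/-- A point of the carrier as a torus site. [folklore] -/
def toSite (x : UT N) : TSite d N := x

/-- `toSite ∘ ofSite = id`. [folklore] -/
@[simp] theorem toSite_ofSite (x : TSite d N) : toSite N (ofSite N x) = x := rfl

/-- The unit torus is finite. [folklore] -/
instance : Fintype (UT N) := inferInstanceAs (Fintype (TSite d N))

/-- Equality of torus points is decidable. [folklore] -/
instance : DecidableEq (UT N) := inferInstanceAs (DecidableEq (TSite d N))

/-- The sup torus distance makes the unit torus a pseudometric space. [folklore] -/
instance [∀ i, NeZero (N i)] : PseudoMetricSpace (UT N) where
  dist x y := tdist N (toSite N x) (toSite N y)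
  dist_self x := tdist_self N _
  dist_comm x y := tdist_symm (one_le N) _ _
  dist_triangle x y z := tdist_triangle (one_le N) _ _ _

/-- `dist = tdist`. [folklore] -/
theorem dist_eq [∀ i, NeZero (N i)] (x y : UT N) : dist x y = tdist N (toSite N x) (toSite N y) := rfl

/-- `dist (ofSite x) (ofSite y) = tdist x y`. [folklore] -/
@[simp] theorem dist_ofSite [∀ i, NeZero (N i)] (x y : TSite d N) :
    dist (ofSite N x) (ofSite N y) = tdist N x y := rfl

end UT

section Realisation

variable {d : ℕ} (N : Fin d → ℕ) [∀ i, NeZero (N i)]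

/-- The centres of the cube cover as points of the carrier `UT N` (the `ctr : S → X` of `B5Local114.Realisation`).
[cite: Balaban1984PropagatorsI, p.36] -/
def ctrU (M₀ : ℕ) (k : Ctr N M₀) : UT N := UT.ofSite N (ctr (UT.one_le N) M₀ k)

/-- **The field `hν` of `B5Local114.Realisation`, DISCHARGED on the unit torus** with `X := UT N`, `S := Ctr N M₀`,
`ctr := ctrU N M₀`, `κ.cbar := c̄ ≥ 0` and `κ.nu := (2c̄ + 3)^d`, for every `M₀ ≥ 1` and every torus. [cite: Balaban1984PropagatorsI, p.36] -/
theorem hnu_holds {M₀ : ℕ} (hM : 1 ≤ M₀) {cbar : ℝ} (hc : 0 ≤ cbar) (x : UT N) :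
    ((Finset.univ.filter fun z : Ctr N M₀ => dist x (ctrU N M₀ z) ≤ cbar * M₀).card : ℝ) ≤ (2 * cbar + 3) ^ d :=
  coverMult_le (UT.one_le N) hM hc (UT.toSite N x)

/-- **The field `hrow` of `B5Local114.Realisation`, DISCHARGED on the unit torus** with `κ.Kbar := (1 + 4d·e^{1/d})^d`,
for every `M₀ ≥ 1` and every torus. [cite: Balaban1984PropagatorsI, (1.131) p.38] -/
theorem hrow_holds {M₀ : ℕ} (hM : 1 ≤ M₀) (a : Ctr N M₀) :
    ∑ b : Ctr N M₀, Real.exp (-((2 * (M₀ : ℝ))⁻¹ * dist (ctrU N M₀ a) (ctrU N M₀ b)))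
      ≤ (1 + 4 * d * Real.exp (1 / d)) ^ d :=
  coverRowSum_half_le (UT.one_le N) hM a

/-- `hν` in the literal binder shape of `B5Local114.Realisation (St) (kd) M₀ κ V (UT N) (Ctr N M₀)` with
`ctr := ctrU N M₀`, for any constants table with `(2c̄ + 3)^d ≤ κ.nu`. [cite: Balaban1984PropagatorsI, p.36] -/
theorem hnu_field (κ : B5Local114.Consts) (hnu : (2 * κ.cbar + 3) ^ d ≤ κ.nu) {M₀ : ℕ} (hM : 1 ≤ M₀) :
    ∀ x : UT N, ((Finset.univ.filter fun z : Ctr N M₀ => dist x (ctrU N M₀ z) ≤ κ.cbar * M₀).card : ℝ) ≤ κ.nu :=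
  fun x => (hnu_holds N hM κ.cbar_nonneg x).trans hnu

/-- `hrow` in the literal binder shape of `B5Local114.Realisation … (UT N) (Ctr N M₀)` with `ctr := ctrU N M₀`, for
any constants table with `(1 + 4d·e^{1/d})^d ≤ κ.Kbar`. [cite: Balaban1984PropagatorsI, (1.131) p.38] -/
theorem hrow_field (κ : B5Local114.Consts) (hK : (1 + 4 * d * Real.exp (1 / d)) ^ d ≤ κ.Kbar) {M₀ : ℕ}
    (hM : 1 ≤ M₀) :
    ∀ a : Ctr N M₀, ∑ b : Ctr N M₀, Real.exp (-((2 * (M₀ : ℝ))⁻¹ * dist (ctrU N M₀ a) (ctrU N M₀ b))) ≤ κ.Kbar :=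
  fun a => (hrow_holds N hM a).trans hK

/-- **The field `hdist` of `B5Local114.Realisation`** (`St.dist y y′ ≤ dist (site y) (site y′)`) for a setting whose
distance IS the torus distance through an injection `e` (`site := UT.ofSite N ∘ e`). [folklore] -/
theorem hdist_holds {St : B5.Setting} (e : St.Site → TSite d N)
    (he : ∀ y y' : St.Site, St.dist y y' = tdist N (e y) (e y')) :
    ∀ y y' : St.Site, St.dist y y' ≤ dist (UT.ofSite N (e y)) (UT.ofSite N (e y')) :=
  fun y y' => (he y y').le

/-- The chart of such a setting (for §3: `URow`, `hRow`, `nbr_card`). [folklore] -/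
def chartOf {St : B5.Setting} (e : St.Site → TSite d N) (hinj : Function.Injective e)
    (he : ∀ y y' : St.Site, St.dist y y' = tdist N (e y) (e y')) : Chart St.Site St.dist d where
  N := N
  hN := UT.one_le N
  e := e
  inj := hinj
  le := fun y y' => (he y y').ge

end Realisation

end

end Literature.MathematicalPhysics.QuantumFieldTheory.Balaban1983to89.B5TorusCover
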